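import Literature.Computability.AlgebraicComplexity.BI17SL3InvariantDimensionProofs
import Literature.Computability.AlgebraicComplexity.BI17GenericPeriodTwoProofs
import Mathlib.Data.Int.GCD
import HarnessLib

/-!
# Bürgisser–Ikenmeyer 2017, Thm. 4.2: `a(3) = 1` — PROOF, and Thm. 4.2 from Popov's theorem BY NAME

P. Bürgisser, C. Ikenmeyer, *Fundamental invariants of orbit closures*, J. Algebra **477** (2017)
390–434 = arXiv:1511.02927 [BurgisserIkenmeyer2017], §4.1, Thm. 4.2 (TeX `main.tex` L1612, held
text `paper:arxiv-1511.02927` p0015:L51: "We have `a(m) = 1` for `m ≥ 3` and `a(2) = 2`"; proof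
L1616–1620, p0015:L55–62: "A. M. Popov [Popov 1987] proved that if `m > 3`, then almost all
`w ∈ ⊗³ℂ^m` have a trivial stabilizer group, hence `a(m) = 1`. … The isomorphism classes of tensors
in `⊗³ℂ³` have been classified by Thrall and Chanler [1938], see also [Ng 1995]. This reveals that
`a(w) = 1` for a generic `w ∈ ⊗³ℂ³`"; and p0015:L45: "It is clear that a tensor with trivial
stabilizer has the stabilizer period `1`"). THEOREMS ONLY; sibling of the statement file
`BI17FundamentalInvariantTensors.lean` (val-lit row BI2017-B), whose named fact `BI2017_thm_4_2` is
the conjunction of the clause `m ≥ 3` and the clause `m = 2`; the latter is the tree's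
`BI2017_thm_4_2_two` (`BI17GenericPeriodTwoProofs.lean`). Nothing is restated, no new named fact.

* `BI2017_thm_4_2_three` — **the case `m = 3`, PROVED unconditionally**: almost all `w ∈ ⊗³ℂ³`
  have stabilizer period `a(w) = 1`.
* `tensorStabilizerPeriod_eq_one_of_hasTrivialTensorStabilizer` — "a tensor with trivial
  stabilizer has the stabilizer period `1`" (p0015:L45).
* `BI2017_thm_4_2_of_popov : BI2017_popov_trivialStabilizer → BI2017_thm_4_2` — the named fact
  follows BY NAME from exactly the external input of the printed proof, A. M. Popov's theorem
  (generic trivial stabilizer for `m > 3`, the tree's cite-fact `BI2017_popov_trivialStabilizer`,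
  A. M. Popov, Trudy Moskov. Mat. Obshch. 50 (1987), Thm. 2 — not held, not proved here); and
  `BI2017_thm_4_2_iff_four_le`: the fact is EQUIVALENT to its clause `m ≥ 4` (the clauses `m = 2`
  and `m = 3` being theorems of the tree).

## Proof of the case `m = 3` (ours — by invariant degrees instead of the Thrall–Chanler classification)

The print cites the classification of `⊗³ℂ³`. We replace it by the degree monoid `E(3)`, which
the tree already knows: `E(3) = {3δ : δ ≠ 1}` (`BI2017_ex_5_5_degreeMonoid`, BI Ex. 5.5, with the
Kronecker coefficients `k_3(2), k_3(3) > 0` certified in the kernel), so there are NONZERO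
homogeneous `SL₃³`-invariants `F₆` of degree `6` and `F₉` of degree `9` on `⊗³ℂ³` (in print:
"`k_3(3) = 1` states the existence and uniqueness of Strassen's invariant"; `F₆` is the classical
degree-6 invariant). A homogeneous `SL_m³`-invariant `F` of degree `d` is a `GL_m³`-semi-invariant:
writing `gᵢ = tᵢ sᵢ` with `sᵢ ∈ SL_m`, `tᵢ^m = det gᵢ` and `τ = t₁t₂t₃` one has `F(g·w) = τ^d F(w)`
and `τ^m = det g₁ det g₂ det g₃ = χ(g)` (`exists_pow_eq_tensorChi_and_aeval_actTensor`; this is the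
map `ι(t)` of the proof of BI Lemma 5.1). Hence for `g ∈ stab(w)` with `F₆(w) F₉(w) ≠ 0`:
`τ⁶ = τ⁹ = 1`, so `τ³ = τ^{gcd(6,9)} = 1` (`pow_gcd_eq_one`), i.e. `χ(g) = τ³ = 1`; thus
`χ(stab(w)) = {1}` and `a(w) = 1` off the hypersurface `{F₆ F₉ = 0}`
(`tensorStabilizerPeriod_eq_one_of_sl3Invariants`, stated for any `m` and any two invariant degrees
with `gcd ∣ m`). For `m > 3` a trivial reduced stabilizer `gᵢ = ζᵢ·id`, `ζ₁ζ₂ζ₃ = 1`, gives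
`χ(g) = (ζ₁ζ₂ζ₃)^m = 1` directly.

Honest framing: typed-literature proofs for the cell `val-lit` (LADDER-VALIANT V3, a known-results
layer); nothing here bears on VP versus VNP. `BI2017_thm_4_2` remains a named fact, now reduced to
(indeed equivalent to the `m ≥ 4` clause supplied by) Popov's theorem.

## References

* [BurgisserIkenmeyer2017] P. Bürgisser, C. Ikenmeyer, *Fundamental invariants of orbit closures*,
  J. Algebra 477 (2017) 390–434; arXiv:1511.02927, §4.1 Thm. 4.2, §5 Lemma 5.1, Ex. 5.5.
* A. M. Popov, *Irreducible semisimple linear Lie groups with finite stationary subgroups of general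
  position* (Russian), Trudy Moskov. Mat. Obshch. 50 (1987) 209–248, Thm. 2 (as quoted in BI 2017,
  proof of Thm. 4.2).
* R. M. Thrall, J. H. Chanler, *Ternary trilinear forms in the field of complex numbers*, Duke
  Math. J. 4 (1938) 678–690 (the classification cited in print; not used here).
-/

noncomputable section

open MvPolynomial Matrix

namespace Literature.Computability.AlgebraicComplexity

/-! ### Period one from the character on the stabilizer -/

section PeriodOne

variable {ι : Type*} [Fintype ι] [DecidableEq ι]

/-- If `χ` is trivial on `stab(w)` then `χ(stab(w)) = {1}` and the stabilizer period is `a(w) = 1`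
(Def. 4.1: "the order of `χ(stab(w))`"). [cite: BurgisserIkenmeyer2017, Def. 4.1] -/
theorem tensorStabilizerPeriod_eq_one_of_forall_tensorChi_eq_one (w : ι → ι → ι → ℂ)
    (h : ∀ g ∈ tensorStab w, tensorChi g = 1) : tensorStabilizerPeriod w = 1 := by
  have himg : tensorStabChiImage w = {1} := by
    refine Set.eq_singleton_iff_unique_mem.mpr ⟨⟨1, ?_, by simp [tensorChi]⟩, ?_⟩
    · rw [mem_tensorStab_iff]
      simp only [Prod.fst_one, Prod.snd_one, Units.val_one, actTensor_one]
    · rintro x ⟨g, hg, rfl⟩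
      exact h g hg
  unfold tensorStabilizerPeriod
  rw [himg]
  exact Nat.card_unique

omit [Fintype ι] [DecidableEq ι] in
/-- `det(ζ·id) = ζ^m`. [folklore] -/
private theorem det_smul_one' [Fintype ι] [DecidableEq ι] (ζ : ℂ) :
    (ζ • (1 : Matrix ι ι ℂ)).det = ζ ^ Fintype.card ι := by
  rw [Matrix.det_smul, Matrix.det_one, mul_one]

/-- **"It is clear that a tensor with trivial stabilizer has the stabilizer period `1`"** (BI 2017
§4.1, p0015:L45): if every `g ∈ stab(w)` lies in the kernel
`K = {(ζ₁ id, ζ₂ id, ζ₃ id) | ζ₁ζ₂ζ₃ = 1}`, then `χ(g) = (ζ₁ζ₂ζ₃)^m = 1`, so `a(w) = 1`.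
[cite: BurgisserIkenmeyer2017, §4.1 (before Thm. 4.2)] -/
theorem tensorStabilizerPeriod_eq_one_of_hasTrivialTensorStabilizer {w : ι → ι → ι → ℂ}
    (h : HasTrivialTensorStabilizer w) : tensorStabilizerPeriod w = 1 := by
  refine tensorStabilizerPeriod_eq_one_of_forall_tensorChi_eq_one w fun g hg => ?_
  obtain ⟨ζ₁, ζ₂, ζ₃, hζ, h₁, h₂, h₃⟩ := h g hg
  apply Units.ext
  simp only [tensorChi, Units.val_mul, Matrix.GeneralLinearGroup.val_det_apply, h₁, h₂, h₃,
    Units.val_one, det_smul_one']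
  rw [← mul_pow, ← mul_pow, hζ, one_pow]

omit [DecidableEq ι] in
/-- `(aA ⊗ bB ⊗ cC)·t = (abc)·((A ⊗ B ⊗ C)·t)`. [folklore] -/
private theorem actTensor_smul₃ (a b c : ℂ) (A B C : Matrix ι ι ℂ) (t : ι → ι → ι → ℂ) :
    actTensor (a • A) (b • B) (c • C) t = (a * b * c) • actTensor A B C t := by
  funext x y z
  simp only [actTensor_apply, Pi.smul_apply, Matrix.smul_apply, smul_eq_mul, Finset.mul_sum]
  refine Finset.sum_congr rfl fun _ _ => Finset.sum_congr rfl fun _ _ =>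
    Finset.sum_congr rfl fun _ _ => by ring

/-- **Homogeneous `SL_m³`-invariants are `GL_m³`-semi-invariants** (the map `ι(t) = (t·id, id, id)`
of the proof of Lemma 5.1, L1954–1976): for `g ∈ GL_m³` there is `τ ∈ ℂ` with
`τ^m = χ(g) = det g₁ det g₂ det g₃` such that `F(g·w) = τ^d F(w)` for EVERY homogeneous
`SL_m³`-invariant `F` of degree `d` (write `gᵢ = tᵢ sᵢ`, `sᵢ ∈ SL_m`, `τ = t₁t₂t₃`).
[cite: BurgisserIkenmeyer2017, Lemma 5.1 (proof)] -/
theorem exists_pow_eq_tensorChi_and_aeval_actTensor [Nonempty ι] (g : GL ι ℂ × GL ι ℂ × GL ι ℂ)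
    (w : ι → ι → ι → ℂ) :
    ∃ τ : ℂ, τ ^ Fintype.card ι = ((tensorChi g : ℂˣ) : ℂ) ∧
      ∀ {F : MvPolynomial (ι × ι × ι) ℂ} {d : ℕ}, F.IsHomogeneous d → IsSL3Invariant F →
        aeval (tensorPt (actTensor (g.1 : Matrix ι ι ℂ) (g.2.1 : Matrix ι ι ℂ)
          (g.2.2 : Matrix ι ι ℂ) w)) F = τ ^ d * aeval (tensorPt w) F := by
  have hm : 0 < Fintype.card ι := Fintype.card_pos
  -- an `m`-th root `t` of `det u` with `u = t • s`, `det s = 1`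
  have root : ∀ u : GL ι ℂ, ∃ (t : ℂ) (s : Matrix.SpecialLinearGroup ι ℂ),
      t ^ Fintype.card ι = (u : Matrix ι ι ℂ).det ∧ (u : Matrix ι ι ℂ) = t • (s : Matrix ι ι ℂ) := by
    intro u
    have hdet : (u : Matrix ι ι ℂ).det ≠ 0 := by
      rw [← Matrix.GeneralLinearGroup.val_det_apply]; exact Units.ne_zero _
    obtain ⟨t, ht⟩ := IsAlgClosed.exists_pow_nat_eq (u : Matrix ι ι ℂ).det hm
    have ht0 : t ≠ 0 := by
      rintro rfl
      rw [zero_pow hm.ne'] at ht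
      exact hdet ht.symm
    refine ⟨t, ⟨t⁻¹ • (u : Matrix ι ι ℂ), ?_⟩, ht, ?_⟩
    · rw [Matrix.det_smul, ← ht, inv_pow, inv_mul_cancel₀ (pow_ne_zero _ ht0)]
    · change (u : Matrix ι ι ℂ) = t • (t⁻¹ • (u : Matrix ι ι ℂ))
      rw [smul_smul, mul_inv_cancel₀ ht0, one_smul]
  obtain ⟨t₁, s₁, h₁, hg₁⟩ := root g.1
  obtain ⟨t₂, s₂, h₂, hg₂⟩ := root g.2.1
  obtain ⟨t₃, s₃, h₃, hg₃⟩ := root g.2.2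
  refine ⟨t₁ * t₂ * t₃, ?_, fun {F d} hF hinv => ?_⟩
  · simp only [tensorChi, Units.val_mul, Matrix.GeneralLinearGroup.val_det_apply, mul_pow, h₁, h₂,
      h₃]
  · rw [hg₁, hg₂, hg₃, actTensor_smul₃]
    rw [show tensorPt ((t₁ * t₂ * t₃) • actTensor (s₁ : Matrix ι ι ℂ) (s₂ : Matrix ι ι ℂ)
          (s₃ : Matrix ι ι ℂ) w) =
        (t₁ * t₂ * t₃) • tensorPt (actTensor (s₁ : Matrix ι ι ℂ) (s₂ : Matrix ι ι ℂ)
          (s₃ : Matrix ι ι ℂ) w) from rfl]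
    simp only [MvPolynomial.aeval_eq_eval]
    rw [hF.eval_smul_eq, ← MvPolynomial.aeval_eq_eval, ← MvPolynomial.aeval_eq_eval,
      hinv s₁ s₂ s₃ w]

/-- **Two nonvanishing invariants of coprime-enough degrees force period one.** If homogeneous
`SL_m³`-invariants `F`, `G` of degrees `d`, `e` with `gcd(d, e) ∣ m` do not vanish at `w`, then
`a(w) = 1`: for `g ∈ stab(w)`, `F(w) = F(gw) = τ^d F(w)` gives `τ^d = 1`, likewise `τ^e = 1`, so
`τ^{gcd(d,e)} = 1` and `χ(g) = τ^m = 1`. (For `m = 3`: `d = 6`, `e = 9`.)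
[cite: BurgisserIkenmeyer2017, Thm. 4.2 and Lemma 5.1 (proof)] -/
theorem tensorStabilizerPeriod_eq_one_of_sl3Invariants [Nonempty ι] (w : ι → ι → ι → ℂ)
    {F G : MvPolynomial (ι × ι × ι) ℂ} {d e : ℕ}
    (hFh : F.IsHomogeneous d) (hFi : IsSL3Invariant F) (hFw : aeval (tensorPt w) F ≠ 0)
    (hGh : G.IsHomogeneous e) (hGi : IsSL3Invariant G) (hGw : aeval (tensorPt w) G ≠ 0)
    (hgcd : Nat.gcd d e ∣ Fintype.card ι) : tensorStabilizerPeriod w = 1 := by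
  refine tensorStabilizerPeriod_eq_one_of_forall_tensorChi_eq_one w fun g hg => ?_
  obtain ⟨τ, hτ, hsemi⟩ := exists_pow_eq_tensorChi_and_aeval_actTensor g w
  have hgw := (mem_tensorStab_iff w g).1 hg
  have hFd : τ ^ d = 1 := by
    have h := hsemi hFh hFi
    rw [hgw] at h
    exact (mul_eq_right₀ hFw).1 h.symm
  have hGe : τ ^ e = 1 := by
    have h := hsemi hGh hGi
    rw [hgw] at h
    exact (mul_eq_right₀ hGw).1 h.symm
  have hτg : τ ^ Nat.gcd d e = 1 := pow_gcd_eq_one.2 ⟨hFd, hGe⟩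
  obtain ⟨k, hk⟩ := hgcd
  apply Units.ext
  rw [← hτ, hk, pow_mul, hτg, one_pow, Units.val_one]

end PeriodOne

/-! ### Thm. 4.2: the case `m = 3`, and the named fact from Popov's theorem -/

section ThmFourTwo

/-- **BI 2017, Thm. 4.2, case `m = 3`: `a(3) = 1` — PROVED.** Almost all `w ∈ ⊗³ℂ³` have stabilizer
period `1`: off the zero set of `F₆ F₉`, where `F₆`, `F₉` are nonzero homogeneous `SL₃³`-invariants
of degrees `6` and `9` (they exist since `6, 9 ∈ E(3) = {3δ : δ ≠ 1}`, `BI2017_ex_5_5_degreeMonoid`;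
in print "`k_3(3) = 1` states the existence and uniqueness of Strassen's invariant"), by
`tensorStabilizerPeriod_eq_one_of_sl3Invariants` with `gcd(6, 9) = 3`. (The print derives the case
`m = 3` from the Thrall–Chanler classification of `⊗³ℂ³` instead.)
[cite: BurgisserIkenmeyer2017, Thm. 4.2] -/
theorem BI2017_thm_4_2_three :
    IsZariskiGenericTensor fun w : Fin 3 → Fin 3 → Fin 3 → ℂ => tensorStabilizerPeriod w = 1 := by
  have h6 : 6 ∈ genericTensorDegreeMonoid (Fin 3) ℂ := by
    rw [BI2017_ex_5_5_degreeMonoid]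
    exact ⟨2, rfl, by decide⟩
  have h9 : 9 ∈ genericTensorDegreeMonoid (Fin 3) ℂ := by
    rw [BI2017_ex_5_5_degreeMonoid]
    exact ⟨3, rfl, by decide⟩
  obtain ⟨F, hFh, hFi, hF0⟩ := h6
  obtain ⟨G, hGh, hGi, hG0⟩ := h9
  refine ⟨F * G, mul_ne_zero hF0 hG0, fun w hw => ?_⟩
  rw [map_mul] at hw
  have hgcd : Nat.gcd 6 9 ∣ Fintype.card (Fin 3) := by
    rw [Fintype.card_fin]
    norm_num
  exact tensorStabilizerPeriod_eq_one_of_sl3Invariants w hFh hFi (left_ne_zero_of_mul hw)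
    hGh hGi (right_ne_zero_of_mul hw) hgcd

/-- **BI 2017, Thm. 4.2, the clause `m > 3` from Popov's theorem**: "if `m > 3`, then almost all
`w ∈ ⊗³ℂ^m` have a trivial stabilizer group, hence `a(m) = 1`" (p0015:L55–57).
[cite: BurgisserIkenmeyer2017, Thm. 4.2 (proof)] -/
theorem BI2017_thm_4_2_of_popov_of_lt (h : BI2017_popov_trivialStabilizer) (m : ℕ) (hm : 3 < m) :
    IsZariskiGenericTensor fun w : Fin m → Fin m → Fin m → ℂ => tensorStabilizerPeriod w = 1 :=
  (h m hm).mono fun _ hw => tensorStabilizerPeriod_eq_one_of_hasTrivialTensorStabilizer hw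

/-- **BI 2017, Thm. 4.2 is equivalent to its clause `m ≥ 4`**: the clauses `m = 2`
(`BI2017_thm_4_2_two`) and `m = 3` (`BI2017_thm_4_2_three`) are theorems of the tree, so the named
fact `BI2017_thm_4_2` says exactly "`a(m) = 1` for almost all `w ∈ ⊗³ℂ^m`, `m ≥ 4`".
[cite: BurgisserIkenmeyer2017, Thm. 4.2] -/
theorem BI2017_thm_4_2_iff_four_le :
    BI2017_thm_4_2 ↔ ∀ m : ℕ, 4 ≤ m →
      IsZariskiGenericTensor fun w : Fin m → Fin m → Fin m → ℂ => tensorStabilizerPeriod w = 1 := by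
  refine ⟨fun h m hm => h.1 m (le_trans (by norm_num) hm), fun h => ⟨fun m hm => ?_, BI2017_thm_4_2_two⟩⟩
  rcases Nat.eq_or_lt_of_le hm with rfl | hlt
  · exact BI2017_thm_4_2_three
  · exact h m hlt

/-- **BI 2017, Thm. 4.2 from Popov's theorem, BY NAME**: the named fact `BI2017_thm_4_2`
("`a(m) = 1` for `m ≥ 3` and `a(2) = 2`") follows from the cite-fact
`BI2017_popov_trivialStabilizer` (A. M. Popov 1987, Thm. 2, as quoted in the printed proof: generic
trivial stabilizer for `m > 3`) — the case `m = 3` by `BI2017_thm_4_2_three`, the case `m = 2` by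
`BI2017_thm_4_2_two`. [cite: BurgisserIkenmeyer2017, Thm. 4.2] -/
theorem BI2017_thm_4_2_of_popov (h : BI2017_popov_trivialStabilizer) : BI2017_thm_4_2 :=
  BI2017_thm_4_2_iff_four_le.2 fun m hm => BI2017_thm_4_2_of_popov_of_lt h m hm

end ThmFourTwo

end Literature.Computability.AlgebraicComplexity
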